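/-
Copyright: the b2b-balaban T⁴-continuum CRUX team, row NE7b leaf lineage `t4-ne7b-formalise-leaf-02` (gen 134). Project licence.
-/
import Mathlib.Analysis.Real.Sqrt
import Mathlib.Algebra.Order.BigOperators.Ring.Finset
import Mathlib.Data.Fintype.BigOperators

/-!
# THE PATH LETTER AND THE TERM-MULTIPLICITY LETTER OF A LINEAR PARTITION: along a chain of `n` one-coordinate steps each moving the partition column by
# at most `η` in `ℓ²(cubes)`, the column moves by at most `n·η` (Minkowski) — `…AdmissibleFloorLinearPartition`'s `hvar` with `Λ = nη`; and at most
# `(#inc j + 1)·μ₀` cubes are alive on a term with `#inc j` bonds when at most `μ₀` are alive at a site — AFLP's `hμ` (row NE7b, node U5c; residual (R2′)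
# family (2), letter (ℓ1); kernel lemmas)

Cell `pub-balaban`, sub-cell `t4`, spine estimate NE7b (`T4WeightBudget.RelWeightBound`; the cell's OWN estimate — NOT PRINTED in [Bałaban 1983–89],
NOT PROVED).  Crux-route work under `Spine/NE7b/`; NOTHING of Bałaban's is asserted; no `def`; zero `sorry`; no `T4Continuum/Support` leaf (FREEZE (0)).
Imports: Mathlib only (`Analysis.Real.Sqrt` for `Real.sum_mul_le_sqrt_mul_sqrt`, `BigOperators` for `Finset.card_biUnion_le`).

WHY.  `…AdmissibleFloorLinearPartition.ims_floor_of_linear_partition` (AFLP, leaf-05 g157) consumes a linear partition `φ : ι → C → ℝ` through four letters: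
`hsum` (`Σ_s φ_s(c) = 1`), `hmult` (`#{s : φ_s(c) ≠ 0} ≤ μ₀`), the TERM VARIATION `hvar` (`Σ_r (φ_r(c) − φ_r(c_j))² ≤ Λ²` for every bond `c` of the term `j`
against its reference bond `c_j`) and the TERM MULTIPLICITY `hμ` (`#{s : ∃ c ∈ inc j, φ_s(c) ≠ 0 ∨ φ_s(c_j) ≠ 0} ≤ μ`).  `…TentPartitionChain` (TPC) and
`…TentPartitionProduct` (TPP, leaf-05 g157) supply `hsum`, `hmult` (`μ₀ = 2^d`) and the ONE-STEP letter `Σ_S (Φ_S(x′) − Φ_S(x))² ≤ 2∕M²` for sites `x, x′`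
differing by one chain step in one coordinate.  THIS FILE turns a one-step letter into the two TERM letters, abstractly (any family `Φ : K → Y → ℝ`, any
site sequence): (i) the `ℓ²(cubes)` triangle inequality along a chain of `n` steps gives `Σ_S (Φ_S(x_n) − Φ_S(x_0))² ≤ (nη)²`, hence `hvar` with `Λ = Nη`
as soon as every bond of a term is joined to the reference bond by a chain of at most `N` steps (for plaquette ∕ block-average terms of `ℓ¹`-diameter `≤ L + 1`:
`N ≤ L + 1`, `η² = 2∕M²`, so `Λ = (L+1)√2∕M` — NO `2^d` in `Λ`); (ii) `hμ` from `hmult` alone: the cubes alive somewhere on a finite set `T` of bonds number at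
most `#T·μ₀`, and a term's bonds together with its reference bond are `#inc j + 1` bonds.

WHAT IS PROVED ([folklore]):
* §1 (private plumbing) `sqrt_sum_sq_add_le` — Minkowski in `ℓ²` of a finite set: `√(Σ_{i∈s}(u_i + v_i)²) ≤ √(Σ u_i²) + √(Σ v_i²)` (Cauchy–Schwarz
  `Real.sum_mul_le_sqrt_mul_sqrt` BY NAME; alpha-identical to the public `Support/NE3EnergyHessContTwoTerm.sqrt_sum_sq_add_le`, not imported to stay
  Mathlib-only — chair δ-X-PPAL-1), `sum_sq_add_le_sq` (its squared form).
* §2 **`sqrt_sum_sq_path_le`** ∕ **`sum_sq_path_le`** — a site sequence `p : ℕ → Y` with `Σ_S (Φ_S(p(i+1)) − Φ_S(p i))² ≤ η²` for `i < n` (`0 ≤ η`) has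
  `√(Σ_S (Φ_S(p n) − Φ_S(p 0))²) ≤ n·η` and `Σ_S (Φ_S(p n) − Φ_S(p 0))² ≤ (n·η)²` (induction + §1); `sum_sq_path_le_of_le` (`n ≤ N` ⟹ `≤ (N·η)²`).
* §3 **`hvar_of_chains`** — AFLP's `hvar` VERBATIM for `φ_s(c) := Φ_s(pt c)` (bonds `c` read at a site `pt c`, e.g. their start point): if every `c ∈ inc j`
  is joined to `ref j` by a chain of `≤ N` steps obeying the one-step letter, then `Σ_S (Φ_S(pt c) − Φ_S(pt (ref j)))² ≤ (N·η)²`.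
* §4 **`card_alive_on_le`** — `#{s : ∃ c ∈ T, φ_s(c) ≠ 0} ≤ #T·μ₀` from `hmult` (`Finset.card_biUnion_le`); **`card_alive_on_term_le`** — AFLP's `hμ`
  VERBATIM: `#{s : ∃ c ∈ inc j, φ_s(c) ≠ 0 ∨ φ_s(ref j) ≠ 0} ≤ (#inc j + 1)·μ₀`; `card_alive_on_term_le_of_le` (`#inc j ≤ a` ⟹ `≤ (a + 1)·μ₀`).
* §5 toy: a two-step chain with `η = 1` moves a one-cube column by at most `2` (`example` via §2), and one bond with `μ₀ = 1` has `≤ 2` cubes alive on its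
  term (`example` via §4).

NOT HERE (honest): the one-step letter itself (TPC ∕ TPP), the chains on the two-scale torus (`ℤ∕KM`-sites read as (block, offset) per axis; plaquette and
block-average terms have `ℓ¹`-diameter `≤ L + 1`), bonds vs sites, the normalisation (QPU) and the floor (AFLP); anything of Bałaban's.
BY-NAME EFFECT ON THE WALL: NONE.  NE7b NOT PRINTED ∕ NOT PROVED; spine PROVED 0∕9; rung (B)+1 on ONE finite T⁴ — NOT infinite volume, NOT the mass gap, NOT Clay.
HONEST DEPENDENCY: continuum YM on T⁴ ⇐ BetaPertH ∧ nine spine estimates (0/9 proved); BetaPertH ⇐ (D1) ∧ (D4) ∧ CAP+tail; G-an2-4 gates asym, D1 and NE2/3/4.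
-/

set_option autoImplicit false

noncomputable section

open Finset

namespace Summit.QuantumFields.BalabanUV.T4Continuum.NE7b.PartitionPathLetters

variable {K Y : Type*}

/-! ## §1 Minkowski in `ℓ²` of a finite set -/

/-- `Σ_{i∈s}(u_i + v_i)² ≤ (√(Σ u_i²) + √(Σ v_i²))²` (expand and use Cauchy–Schwarz `Σ u_iv_i ≤ √(Σu²)√(Σv²)`).  Private: a plumbing step
for `sqrt_sum_sq_add_le`. [folklore] -/
private theorem sum_sq_add_le_sq (s : Finset K) (u v : K → ℝ) :
    ∑ i ∈ s, (u i + v i) ^ 2 ≤ (Real.sqrt (∑ i ∈ s, u i ^ 2) + Real.sqrt (∑ i ∈ s, v i ^ 2)) ^ 2 := by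
  have hu : 0 ≤ ∑ i ∈ s, u i ^ 2 := Finset.sum_nonneg fun _ _ => sq_nonneg _
  have hv : 0 ≤ ∑ i ∈ s, v i ^ 2 := Finset.sum_nonneg fun _ _ => sq_nonneg _
  have hcs : ∑ i ∈ s, u i * v i ≤ Real.sqrt (∑ i ∈ s, u i ^ 2) * Real.sqrt (∑ i ∈ s, v i ^ 2) :=
    Real.sum_mul_le_sqrt_mul_sqrt s u v
  have hexp : ∑ i ∈ s, (u i + v i) ^ 2 = ∑ i ∈ s, u i ^ 2 + 2 * ∑ i ∈ s, u i * v i + ∑ i ∈ s, v i ^ 2 := by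
    rw [Finset.mul_sum, ← Finset.sum_add_distrib, ← Finset.sum_add_distrib]
    exact Finset.sum_congr rfl fun i _ => by ring
  rw [hexp, add_sq, Real.sq_sqrt hu, Real.sq_sqrt hv]
  nlinarith [hcs]

/-- **MINKOWSKI IN `ℓ²(cubes)`**: `√(Σ_{i∈s}(u_i + v_i)²) ≤ √(Σ u_i²) + √(Σ v_i²)`.  PRIVATE: alpha-identical to the public tree lemma
`Summit.….T4Continuum.Support.NE3EnergyHessContTwoTerm.sqrt_sum_sq_add_le` (chair leaf-04 g159, δ-X-PPAL-1), which is NOT imported here so that this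
letter file stays Mathlib-only; used only by §2. [folklore] -/
private theorem sqrt_sum_sq_add_le (s : Finset K) (u v : K → ℝ) :
    Real.sqrt (∑ i ∈ s, (u i + v i) ^ 2) ≤ Real.sqrt (∑ i ∈ s, u i ^ 2) + Real.sqrt (∑ i ∈ s, v i ^ 2) := by
  rw [Real.sqrt_le_left (add_nonneg (Real.sqrt_nonneg _) (Real.sqrt_nonneg _))]
  exact sum_sq_add_le_sq s u v

/-! ## §2 The path letter: `n` steps of size `η` move the column by at most `n·η` -/

/-- **THE PATH LETTER, ROOT FORM**: along `p : ℕ → Y` with `Σ_S (Φ_S(p(i+1)) − Φ_S(p i))² ≤ η²` for every `i < n` (`0 ≤ η`),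
`√(Σ_S (Φ_S(p n) − Φ_S(p 0))²) ≤ n·η`. [folklore] -/
theorem sqrt_sum_sq_path_le [Fintype K] (Φ : K → Y → ℝ) (p : ℕ → Y) {η : ℝ} (hη : 0 ≤ η) (n : ℕ)
    (hstep : ∀ i < n, ∑ S, (Φ S (p (i + 1)) - Φ S (p i)) ^ 2 ≤ η ^ 2) :
    Real.sqrt (∑ S, (Φ S (p n) - Φ S (p 0)) ^ 2) ≤ n * η := by
  induction n with
  | zero => simp
  | succ n ih =>
    have ih' : Real.sqrt (∑ S, (Φ S (p n) - Φ S (p 0)) ^ 2) ≤ n * η :=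
      ih fun i hi => hstep i (Nat.lt_succ_of_lt hi)
    have hlast : Real.sqrt (∑ S, (Φ S (p (n + 1)) - Φ S (p n)) ^ 2) ≤ η := by
      rw [← Real.sqrt_sq hη]
      exact Real.sqrt_le_sqrt (hstep n (Nat.lt_succ_self n))
    have hsplit : ∑ S, (Φ S (p (n + 1)) - Φ S (p 0)) ^ 2
        = ∑ S, ((Φ S (p (n + 1)) - Φ S (p n)) + (Φ S (p n) - Φ S (p 0))) ^ 2 :=
      Finset.sum_congr rfl fun S _ => by ring
    rw [hsplit]
    calc Real.sqrt (∑ S, ((Φ S (p (n + 1)) - Φ S (p n)) + (Φ S (p n) - Φ S (p 0))) ^ 2)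
        ≤ Real.sqrt (∑ S, (Φ S (p (n + 1)) - Φ S (p n)) ^ 2) + Real.sqrt (∑ S, (Φ S (p n) - Φ S (p 0)) ^ 2) :=
          sqrt_sum_sq_add_le Finset.univ _ _
      _ ≤ η + n * η := add_le_add hlast ih'
      _ = (n + 1 : ℕ) * η := by push_cast; ring

/-- **THE PATH LETTER**: `Σ_S (Φ_S(p n) − Φ_S(p 0))² ≤ (n·η)²` under the one-step letter for `i < n`. [folklore] -/
theorem sum_sq_path_le [Fintype K] (Φ : K → Y → ℝ) (p : ℕ → Y) {η : ℝ} (hη : 0 ≤ η) (n : ℕ)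
    (hstep : ∀ i < n, ∑ S, (Φ S (p (i + 1)) - Φ S (p i)) ^ 2 ≤ η ^ 2) :
    ∑ S, (Φ S (p n) - Φ S (p 0)) ^ 2 ≤ (n * η) ^ 2 := by
  have h := sqrt_sum_sq_path_le Φ p hη n hstep
  have h0 : 0 ≤ ∑ S, (Φ S (p n) - Φ S (p 0)) ^ 2 := Finset.sum_nonneg fun _ _ => sq_nonneg _
  rw [← Real.sq_sqrt h0]
  exact pow_le_pow_left₀ (Real.sqrt_nonneg _) h 2

/-- … and `≤ (N·η)²` for any `N ≥ n` (terms come with a uniform bound `N` on their chain lengths). [folklore] -/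
theorem sum_sq_path_le_of_le [Fintype K] (Φ : K → Y → ℝ) (p : ℕ → Y) {η : ℝ} (hη : 0 ≤ η) {n N : ℕ} (hnN : n ≤ N)
    (hstep : ∀ i < n, ∑ S, (Φ S (p (i + 1)) - Φ S (p i)) ^ 2 ≤ η ^ 2) :
    ∑ S, (Φ S (p n) - Φ S (p 0)) ^ 2 ≤ (N * η) ^ 2 :=
  (sum_sq_path_le Φ p hη n hstep).trans <|
    pow_le_pow_left₀ (mul_nonneg (Nat.cast_nonneg _) hη) (mul_le_mul_of_nonneg_right (by exact_mod_cast hnN) hη) 2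

/-! ## §3 AFLP's term-variation letter `hvar` from chains -/

/-- **AFLP's `hvar` FROM CHAINS**: bonds `c : C` are read at sites `pt c : Y` (`φ_s(c) := Φ_s(pt c)`); if every bond `c ∈ inc j` of a term is joined to the
reference bond `ref j` by a chain `p` of `n ≤ N` steps (`p 0 = pt (ref j)`, `p n = pt c`) each obeying the one-step letter `≤ η²`, then
`Σ_S (φ_S(c) − φ_S(ref j))² ≤ (N·η)²` — the `hvar` binder of `ims_floor_of_linear_partition` with `Λ := N·η`. [folklore] -/
theorem hvar_of_chains [Fintype K] {C J : Type*} (Φ : K → Y → ℝ) (pt : C → Y) (inc : J → Finset C) (ref : J → C)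
    {η : ℝ} (hη : 0 ≤ η) (N : ℕ)
    (hchain : ∀ j, ∀ c ∈ inc j, ∃ n ≤ N, ∃ p : ℕ → Y, p 0 = pt (ref j) ∧ p n = pt c ∧
      ∀ i < n, ∑ S, (Φ S (p (i + 1)) - Φ S (p i)) ^ 2 ≤ η ^ 2) :
    ∀ j, ∀ c ∈ inc j, ∑ S, (Φ S (pt c) - Φ S (pt (ref j))) ^ 2 ≤ (N * η) ^ 2 := by
  intro j c hc
  obtain ⟨n, hnN, p, hp0, hpn, hstep⟩ := hchain j c hc
  rw [← hp0, ← hpn]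
  exact sum_sq_path_le_of_le Φ p hη hnN hstep

/-! ## §4 AFLP's term-multiplicity letter `hμ` from the site multiplicity `μ₀` -/

section Multiplicity

variable {ι C : Type*} [Fintype ι]

/-- **`#{s : ∃ c ∈ T, φ_s(c) ≠ 0} ≤ #T·μ₀`** when at most `μ₀` cubes are alive at every bond (the alive-on-`T` set is the union over `c ∈ T` of the
alive-at-`c` sets). [folklore] -/
theorem card_alive_on_le (φ : ι → C → ℝ) {μ₀ : ℕ} (hmult : ∀ c, (Finset.univ.filter fun s => φ s c ≠ 0).card ≤ μ₀) (T : Finset C) :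
    (Finset.univ.filter fun s => ∃ c ∈ T, φ s c ≠ 0).card ≤ T.card * μ₀ := by
  classical
  have hsub : (Finset.univ.filter fun s => ∃ c ∈ T, φ s c ≠ 0) ⊆ T.biUnion fun c => Finset.univ.filter fun s => φ s c ≠ 0 := by
    intro s hs
    rw [Finset.mem_filter] at hs
    obtain ⟨c, hc, hne⟩ := hs.2
    exact Finset.mem_biUnion.mpr ⟨c, hc, Finset.mem_filter.mpr ⟨Finset.mem_univ _, hne⟩⟩
  calc (Finset.univ.filter fun s => ∃ c ∈ T, φ s c ≠ 0).card
      ≤ (T.biUnion fun c => Finset.univ.filter fun s => φ s c ≠ 0).card := Finset.card_le_card hsub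
    _ ≤ ∑ c ∈ T, (Finset.univ.filter fun s => φ s c ≠ 0).card := Finset.card_biUnion_le
    _ ≤ ∑ _c ∈ T, μ₀ := Finset.sum_le_sum fun c _ => hmult c
    _ = T.card * μ₀ := by rw [Finset.sum_const, smul_eq_mul]

/-- **AFLP's `hμ` FROM `hmult`**: `#{s : ∃ c ∈ inc j, φ_s(c) ≠ 0 ∨ φ_s(ref j) ≠ 0} ≤ (#inc j + 1)·μ₀` (the term's bonds together with the reference bond
are at most `#inc j + 1` bonds). [folklore] -/
theorem card_alive_on_term_le {J : Type*} (φ : ι → C → ℝ) {μ₀ : ℕ}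
    (hmult : ∀ c, (Finset.univ.filter fun s => φ s c ≠ 0).card ≤ μ₀) (inc : J → Finset C) (ref : J → C) (j : J) :
    (Finset.univ.filter fun s => ∃ c ∈ inc j, φ s c ≠ 0 ∨ φ s (ref j) ≠ 0).card ≤ ((inc j).card + 1) * μ₀ := by
  classical
  have hsub : (Finset.univ.filter fun s => ∃ c ∈ inc j, φ s c ≠ 0 ∨ φ s (ref j) ≠ 0)
      ⊆ Finset.univ.filter fun s => ∃ c ∈ insert (ref j) (inc j), φ s c ≠ 0 := by
    refine Finset.monotone_filter_right _ fun s _ hs => ?_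
    obtain ⟨c, hc, h⟩ := hs
    rcases h with h | h
    · exact ⟨c, Finset.mem_insert_of_mem hc, h⟩
    · exact ⟨ref j, Finset.mem_insert_self _ _, h⟩
  calc (Finset.univ.filter fun s => ∃ c ∈ inc j, φ s c ≠ 0 ∨ φ s (ref j) ≠ 0).card
      ≤ (Finset.univ.filter fun s => ∃ c ∈ insert (ref j) (inc j), φ s c ≠ 0).card := Finset.card_le_card hsub
    _ ≤ (insert (ref j) (inc j)).card * μ₀ := card_alive_on_le φ hmult _
    _ ≤ ((inc j).card + 1) * μ₀ := Nat.mul_le_mul_right _ (Finset.card_insert_le _ _)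

/-- … and `≤ (a + 1)·μ₀` for any `a ≥ #inc j` (AFLP's `ha : #inc j ≤ a` — four bonds per plaquette, `L^d`-type counts per block average). [folklore] -/
theorem card_alive_on_term_le_of_le {J : Type*} (φ : ι → C → ℝ) {μ₀ : ℕ}
    (hmult : ∀ c, (Finset.univ.filter fun s => φ s c ≠ 0).card ≤ μ₀) (inc : J → Finset C) (ref : J → C) {a : ℕ}
    (ha : ∀ j, (inc j).card ≤ a) (j : J) :
    (Finset.univ.filter fun s => ∃ c ∈ inc j, φ s c ≠ 0 ∨ φ s (ref j) ≠ 0).card ≤ (a + 1) * μ₀ :=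
  (card_alive_on_term_le φ hmult inc ref j).trans (Nat.mul_le_mul_right _ (Nat.add_le_add_right (ha j) 1))

end Multiplicity

/-! ## §5 Toys -/

section Toy

/- A two-step chain `p = id : ℕ → ℕ` for the one-cube family `Φ () y := y` (each step moves the column by `1 = η`): the column moves by `≤ 2·1`. -/
example : ∑ S : Unit, ((fun (_ : Unit) (y : ℕ) => (y : ℝ)) S ((fun i => i) 2) - (fun (_ : Unit) (y : ℕ) => (y : ℝ)) S ((fun i => i) 0)) ^ 2
    ≤ (((2 : ℕ) : ℝ) * 1) ^ 2 :=
  sum_sq_path_le (K := Unit) (fun (_ : Unit) (y : ℕ) => (y : ℝ)) (fun i => i) zero_le_one 2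
    (fun i _ => by simp)

/- One bond (`C = Unit`), one cube alive (`φ ≡ 1`, `μ₀ = 1`), a one-bond term: at most `(1 + 1)·1` cubes alive on it. -/
example : (Finset.univ.filter fun s : Unit => ∃ c ∈ ({()} : Finset Unit),
      (fun (_ : Unit) (_ : Unit) => (1 : ℝ)) s c ≠ 0 ∨ (fun (_ : Unit) (_ : Unit) => (1 : ℝ)) s () ≠ 0).card ≤ (1 + 1) * 1 :=
  card_alive_on_term_le (J := Unit) (fun (_ : Unit) (_ : Unit) => (1 : ℝ)) (μ₀ := 1) (fun _ => by simp) (fun _ => {()}) (fun _ => ()) ()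

end Toy

end Summit.QuantumFields.BalabanUV.T4Continuum.NE7b.PartitionPathLetters

end
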